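import Summits.Langlands.Langlands.Statement
import HarnessLib

/-!
# Route SenNullAlignment — BC2 REDIRECT of the junction `SectorComplement` (stmt-Langlands-16308):
# the assembly `OffPlaneReciprocityA → WeakGeometricAutomorphy → CorrespondenceRigidityGL2 →
# CanonicalReciprocityData → SectorComplement`, hypotheses WRITTEN OUT (texts), conclusion
# `OddHilbertReciprocity → Langlands` written out — so that this file imports the Statement only and can
# close the split's glue item BY TEXT (no import of the Theses file; cycle rule).

Support file for item stmt-Langlands-16308 (crux-strategist gen 1, 2026-08-17).  Pure logic, no definitions,
standard axioms.  The four hypotheses are the children filed by `ledger route edit --split SectorComplement`: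

* P1 `OffPlaneReciprocityA` — direction (A) OFF the odd-Hilbert plane (K totally real ∧ n = 2 ∧ π holomorphic of
  some weight (k,w) with totally odd central sign), rigid pair form, for EVERY pinned reciprocity datum: an
  irreducible geometric Satake-a.e. avatar exists, and every irreducible geometric Satake-a.e. avatar is
  locally–globally compatible at every finite place and unique up to conjugacy  [Buzzard–Gee Conj. 3.2.2,
  Taylor 2004 Conj. 7, Deligne–Serre 1974 Lemme 3.2; OPEN];
* P2 `WeakGeometricAutomorphy` — B_w, verbatim item stmt-Langlands-17414  [Fontaine–Mazur Conj. 1 + Langlands; OPEN];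
* P3 `CorrespondenceRigidityGL2` — rigidity of the GL₂ correspondence across pinned data and frames
  [Chebotarev + Brauer–Nesbitt, frame invariance, Henniart 1993 Thm 1.1; theorem-level, T0/line debt];
* P4 `CanonicalReciprocityData` — verbatim item stmt-Langlands-17930, the summit's non-vacuity conjunct
  [Harris–Taylor 2001 Thm A / Henniart 2000 for THE canonical Artin maps; T0 debt].

`X = OddHilbertReciprocity` (the route target) is LOAD-BEARING: on the odd-Hilbert plane it supplies the
irreducible geometric avatar AND its local–global compatibility (for its own datum `RD₀`), which P3 transports to
every datum and every Satake-compatible frame — in clause (A) and in the local–global half of clause (B).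

References: [BuzzardGeeLMS2014] Conj. 3.2.1–3.2.2; [FontaineMazurGeometric1995] Conj. 1;
[TaylorGaloisRepresentations2004] Conj. 7–8; [DeligneSerreASENS1974] Lemme 3.2; [Henniarts1993] Thm 1.1;
[HarrisTaylorAMS2001] Thm A.
-/

noncomputable section

set_option linter.dupNamespace false -- project-wide option; `Summit.Langlands.Langlands` is the mandated namespace

namespace Summit.Langlands.Langlands.Theorems.SenNullAlignmentSectorComplementSplit

open scoped MatrixGroups Matrix Classical Polynomial NumberField BigOperators Topology
open Filter
open Summit.Langlands

/-- **BC2 redirect of `SenNullAlignment.SectorComplement`: the junction from its four pieces** (texts; the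
conclusion is `OddHilbertReciprocity → Langlands` with the route target written out).  Proof: pure logic —
case split on the odd-Hilbert plane; on it the target `X` gives the datum `RD₀`, the irreducible geometric avatar
and its compatibility, transported by P3; off it P1; direction (B) from P2 completed by `X`+P3 on the plane and by
the pair half of P1 off it; non-vacuity is P4.
[cite: BuzzardGeeLMS2014, Conj. 3.2.1 and Conj. 3.2.2] [cite: FontaineMazurGeometric1995, Conj. 1]
[cite: DeligneSerreASENS1974, Lemme 3.2] -/
theorem sectorComplement_of_pieces
    (hA : ∀ (K : Type) [Field K] [NumberField K] (Rec : Summit.Langlands.ReciprocityData K) (n : ℕ) (hcpt : Literature.NumberTheory.Automorphic.isCompact_glFiniteIntegralLevel n K), 0 < n → ∀ (π : Literature.NumberTheory.Automorphic.CuspidalAutomorphicRepData n K hcpt), π.1.IsLAlgebraic → ¬ (NumberField.IsTotallyReal K ∧ n = 2 ∧ ∃ (k : (K →+* ℂ) → ℕ) (w : ℤ), π.1.HasInfinityType (fun β : K →+* ℂ => ({(⟨((k β : ℂ) - 1 - w) / 2, (1 - (k β : ℂ) - w) / 2, (k β : ℤ) - 1, by push_cast; ring⟩ : Literature.NumberTheory.Automorphic.ArchWeight),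 (⟨((k β : ℂ) - 1 - w) / 2, (1 - (k β : ℂ) - w) / 2, (k β : ℤ) - 1, by push_cast; ring⟩ : Literature.NumberTheory.Automorphic.ArchWeight).swap} : Multiset Literature.NumberTheory.Automorphic.ArchWeight)) ∧ (∀ (u : NumberField.InfinitePlace K), ∀ φ ∈ π.1.W, Literature.NumberTheory.Automorphic.rightTranslation (Literature.NumberTheory.Automorphic.AdelicGroupData.gl n K) (Matrix.GeneralLinearGroup.scalar (Fin n) (Units.map (MonoidHom.inl (NumberField.InfiniteAdeleRing K) (IsDedekindDomain.FiniteAdeleRing (NumberField.RingOfIntegers K) K) : NumberField.InfiniteAdeleRing K →* NumberField.AdeleRing (NumberField.RingOfIntegers K) K) (Units.map (MonoidHom.mulSingle (fun u' : NumberField.InfinitePlace K => u'.Completion) u : u.Completion →* NumberField.InfiniteAdeleRing K) (-1)))) φ + φ ∈ π.1.W')) → ∀ (ℓ : ℕ) [Fact ℓ.Prime] (ι : PadicAlgCl ℓ ≃+* ℂ), (∃ ρ : Literature.NumberTheory.GaloisRepresentations.FramedGaloisRep K (PadicAlgCl ℓ) n, ρ.toGaloisRep.IsIrreducible ∧ Summit.Langlands.IsGeometricFramed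 Rec ρ ∧ ∀ᶠ v : IsDedekindDomain.HeightOneSpectrum (NumberField.RingOfIntegers K) in Filter.cofinite, Summit.Langlands.SatakeFrobCompatibleAt ι π.1 ρ v) ∧ ∀ ρ : Literature.NumberTheory.GaloisRepresentations.FramedGaloisRep K (PadicAlgCl ℓ) n, ρ.toGaloisRep.IsIrreducible → Summit.Langlands.IsGeometricFramed Rec ρ → (∀ᶠ v : IsDedekindDomain.HeightOneSpectrum (NumberField.RingOfIntegers K) in Filter.cofinite, Summit.Langlands.SatakeFrobCompatibleAt ι π.1 ρ v) → (∀ v : IsDedekindDomain.HeightOneSpectrum (NumberField.RingOfIntegers K), Summit.Langlands.LocalGlobalCompatibleAt Rec ι π.1 ρ v) ∧ ∀ ρ' : Literature.NumberTheory.GaloisRepresentations.FramedGaloisRep K (PadicAlgCl ℓ) n, (∀ᶠ v : IsDedekindDomain.HeightOneSpectrum (NumberField.RingOfIntegers K) in Filter.cofinite, Summit.Langlands.SatakeFrobCompatibleAt ι π.1 ρ' v) → Summit.Langlands.IsConjugate ρ ρ')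
    (hB : ∀ (K : Type) [Field K] [NumberField K] (n : ℕ) (hcpt : Literature.NumberTheory.Automorphic.isCompact_glFiniteIntegralLevel n K), 0 < n → ∀ (ℓ : ℕ) [Fact ℓ.Prime] (ι : PadicAlgCl ℓ ≃+* ℂ) (ρ : Literature.NumberTheory.GaloisRepresentations.FramedGaloisRep K (PadicAlgCl ℓ) n), ρ.toGaloisRep.IsIrreducible → ((∀ᶠ v : IsDedekindDomain.HeightOneSpectrum (NumberField.RingOfIntegers K) in cofinite, ρ.IsUnramifiedAt v) ∧ ∀ (v : IsDedekindDomain.HeightOneSpectrum (NumberField.RingOfIntegers K)) (hv : ((ℓ : ℕ) : NumberField.RingOfIntegers K) ∈ v.asIdeal), (Literature.NumberTheory.PAdicHodge.fontainePstAdicCompletion v ℓ hv).IsDeRhamFramed (ρ.toLocal v)) → ∃ π : Literature.NumberTheory.Automorphic.CuspidalAutomorphicRepData n K hcpt, π.1.IsLAlgebraic ∧ ∀ᶠ v : IsDedekindDomain.HeightOneSpectrum (NumberField.RingOfIntegers K) in cofinite, SatakeFrobCompatibleAt ι π.1 ρ v)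
    (hR : ∀ (K : Type) [Field K] [NumberField K] (Rec Rec' : Summit.Langlands.ReciprocityData K) (hcpt : Literature.NumberTheory.Automorphic.isCompact_glFiniteIntegralLevel 2 K) (π : Literature.NumberTheory.Automorphic.CuspidalAutomorphicRepData 2 K hcpt) (ℓ : ℕ) [Fact ℓ.Prime] (ι : PadicAlgCl ℓ ≃+* ℂ) (ρ ρ' : Literature.NumberTheory.GaloisRepresentations.FramedGaloisRep K (PadicAlgCl ℓ) 2), ρ.toGaloisRep.IsIrreducible → Summit.Langlands.Corresponds Rec ι π.1 ρ → (∀ᶠ v : IsDedekindDomain.HeightOneSpectrum (NumberField.RingOfIntegers K) in Filter.cofinite, Summit.Langlands.SatakeFrobCompatibleAt ι π.1 ρ' v) → Summit.Langlands.IsConjugate ρ ρ' ∧ Summit.Langlands.Corresponds Rec' ι π.1 ρ')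
    (hN : ∀ (F : Type) [Field F] [NumberField F], Nonempty (Summit.Langlands.ReciprocityData F)) :
    (∀ (K : Type) [Field K] [NumberField K], NumberField.IsTotallyReal K → ∃ RD : Summit.Langlands.ReciprocityData K, ∀ (hcpt : Literature.NumberTheory.Automorphic.isCompact_glFiniteIntegralLevel 2 K) (π : Literature.NumberTheory.Automorphic.CuspidalAutomorphicRepData 2 K hcpt) (k : (K →+* ℂ) → ℕ) (w : ℤ), π.1.IsLAlgebraic → π.1.HasInfinityType (fun β : K →+* ℂ => ({(⟨((k β : ℂ) - 1 - w) / 2, (1 - (k β : ℂ) - w) / 2, (k β : ℤ) - 1, by push_cast; ring⟩ : Literature.NumberTheory.Automorphic.ArchWeight), (⟨((k β : ℂ) - 1 - w) / 2, (1 - (k β : ℂ) - w) / 2, (k β : ℤ) - 1, by push_cast; ring⟩ : Literature.NumberTheory.Automorphic.ArchWeight).swap} : Multiset Literature.NumberTheory.Automorphic.ArchWeight)) → (∀ (u : NumberField.InfinitePlace K), ∀ φ ∈ π.1.W, Literature.NumberTheory.Automorphic.rightTranslation (Literature.NumberTheory.Automorphic.AdelicGroupData.gl 2 K) (Matrix.GeneralLinearGroup.scalar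 (Fin 2) (Units.map (MonoidHom.inl (NumberField.InfiniteAdeleRing K) (IsDedekindDomain.FiniteAdeleRing (NumberField.RingOfIntegers K) K) : NumberField.InfiniteAdeleRing K →* NumberField.AdeleRing (NumberField.RingOfIntegers K) K) (Units.map (MonoidHom.mulSingle (fun u' : NumberField.InfinitePlace K => u'.Completion) u : u.Completion →* NumberField.InfiniteAdeleRing K) (-1)))) φ + φ ∈ π.1.W') → ∀ (ℓ : ℕ) [Fact ℓ.Prime] (ι : PadicAlgCl ℓ ≃+* ℂ), ∃ ρ : Literature.NumberTheory.GaloisRepresentations.FramedGaloisRep K (PadicAlgCl ℓ) 2, ρ.toGaloisRep.IsIrreducible ∧ Summit.Langlands.IsGeometricFramed RD ρ ∧ Summit.Langlands.Corresponds RD ι π.1 ρ) → _root_.Langlands := by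
  intro hX K _ _
  refine ⟨hN K, fun Rec n hn hcpt => ⟨?_, ?_⟩⟩
  · -- (A) automorphic → Galois, for every `Rec`
    intro π hLalg ℓ _ ι
    by_cases hplane : (NumberField.IsTotallyReal K ∧ n = 2 ∧ ∃ (k : (K →+* ℂ) → ℕ) (w : ℤ), π.1.HasInfinityType (fun β : K →+* ℂ => ({(⟨((k β : ℂ) - 1 - w) / 2, (1 - (k β : ℂ) - w) / 2, (k β : ℤ) - 1, by push_cast; ring⟩ : Literature.NumberTheory.Automorphic.ArchWeight), (⟨((k β : ℂ) - 1 - w) / 2, (1 - (k β : ℂ) - w) / 2, (k β : ℤ) - 1, by push_cast; ring⟩ : Literature.NumberTheory.Automorphic.ArchWeight).swap} : Multiset Literature.NumberTheory.Automorphic.ArchWeight)) ∧ (∀ (u : NumberField.InfinitePlace K), ∀ φ ∈ π.1.W, Literature.NumberTheory.Automorphic.rightTranslation (Literature.NumberTheory.Automorphic.AdelicGroupData.gl n K) (Matrix.GeneralLinearGroup.scalar (Fin n) (Units.map (MonoidHom.inl (NumberField.InfiniteAdeleRing K) (IsDedekindDomain.FiniteAdeleRing (NumberField.RingOfIntegers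 K) K) : NumberField.InfiniteAdeleRing K →* NumberField.AdeleRing (NumberField.RingOfIntegers K) K) (Units.map (MonoidHom.mulSingle (fun u' : NumberField.InfinitePlace K => u'.Completion) u : u.Completion →* NumberField.InfiniteAdeleRing K) (-1)))) φ + φ ∈ π.1.W'))
    · obtain ⟨hK, hn2, k, w, hhol, hodd⟩ := hplane
      subst hn2
      obtain ⟨RD₀, hRD₀⟩ := hX K hK
      obtain ⟨ρ, hirr, hgeo, hcorr⟩ := hRD₀ hcpt π k w hLalg hhol hodd ℓ ι
      refine ⟨ρ, hirr, hgeo, (hR K RD₀ Rec hcpt π ℓ ι ρ ρ hirr hcorr hcorr.1).2, fun ρ' hcorr' => ?_⟩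
      exact (hR K RD₀ Rec hcpt π ℓ ι ρ ρ' hirr hcorr hcorr'.1).1
    · obtain ⟨⟨ρ, hirr, hgeo, hsat⟩, hpair⟩ := hA K Rec n hcpt hn π hLalg hplane ℓ ι
      obtain ⟨hlgc, huniq⟩ := hpair ρ hirr hgeo hsat
      exact ⟨ρ, hirr, hgeo, ⟨hsat, hlgc⟩, fun ρ' hcorr' => huniq ρ' hcorr'.1⟩
  · -- (B) Galois → automorphic, for every `Rec`
    intro ℓ _ ι ρ hirr hgeo
    obtain ⟨π, hLalg, hsat⟩ := hB K n hcpt hn ℓ ι ρ hirr hgeo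
    refine ⟨π, hLalg, ?_⟩
    by_cases hplane : (NumberField.IsTotallyReal K ∧ n = 2 ∧ ∃ (k : (K →+* ℂ) → ℕ) (w : ℤ), π.1.HasInfinityType (fun β : K →+* ℂ => ({(⟨((k β : ℂ) - 1 - w) / 2, (1 - (k β : ℂ) - w) / 2, (k β : ℤ) - 1, by push_cast; ring⟩ : Literature.NumberTheory.Automorphic.ArchWeight), (⟨((k β : ℂ) - 1 - w) / 2, (1 - (k β : ℂ) - w) / 2, (k β : ℤ) - 1, by push_cast; ring⟩ : Literature.NumberTheory.Automorphic.ArchWeight).swap} : Multiset Literature.NumberTheory.Automorphic.ArchWeight)) ∧ (∀ (u : NumberField.InfinitePlace K), ∀ φ ∈ π.1.W, Literature.NumberTheory.Automorphic.rightTranslation (Literature.NumberTheory.Automorphic.AdelicGroupData.gl n K) (Matrix.GeneralLinearGroup.scalar (Fin n) (Units.map (MonoidHom.inl (NumberField.InfiniteAdeleRing K) (IsDedekindDomain.FiniteAdeleRing (NumberField.RingOfIntegers K) K) : NumberField.InfiniteAdeleRing K →* NumberField.AdeleRing (NumberField.RingOfIntegers K) K) (Units.map (MonoidHom.mulSingle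 (fun u' : NumberField.InfinitePlace K => u'.Completion) u : u.Completion →* NumberField.InfiniteAdeleRing K) (-1)))) φ + φ ∈ π.1.W'))
    · obtain ⟨hK, hn2, k, w, hhol, hodd⟩ := hplane
      subst hn2
      obtain ⟨RD₀, hRD₀⟩ := hX K hK
      obtain ⟨ρ₁, hirr₁, -, hcorr₁⟩ := hRD₀ hcpt π k w hLalg hhol hodd ℓ ι
      exact (hR K RD₀ Rec hcpt π ℓ ι ρ₁ ρ hirr₁ hcorr₁ hsat).2
    · obtain ⟨-, hpair⟩ := hA K Rec n hcpt hn π hLalg hplane ℓ ι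
      exact ⟨hsat, (hpair ρ hirr hgeo hsat).1⟩

end Summit.Langlands.Langlands.Theorems.SenNullAlignmentSectorComplementSplit

end
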